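import Summits.Ventures.PercRepro.Night2HighFair
import Summits.Ventures.PercRepro.Night2LineLarge

/-!
# night-2: THE HIGH-LEVEL CELLS — no nine collinear points of `W` and `|W| ≥ 15` (gen 39)

Numerical instances of the high-level theorem: `highIncome N 8 ≥ 1` for every `15 ≤ N ≤ 37` (one or two levels
suffice: `N = 15`: levels `11, 12` give `0.98 + 0.37`; `N ≥ 16`: a single level `i ≈ 0.6 N`), `highIncome` is antitone in
`L`, and the cells `(N, L) = (14, 7), (13, 6), (12, 5), (11, 3)`.  With gen 38's large-`G` theorem for `N ≥ 38`:
**`basis_pair_fair_of_lines_le_eight`** — a lossy basis pair whose `W` has at most eight points on every line and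
`|W| ≥ 15` is fair; and the small cells `basis_pair_fair_of_lines_le_small`.
Paper: proofs/NIGHT-2-g39.md §3.
-/

namespace PercRepro.Shadow

open PercRepro.ThmH PercRepro.PerFlat

variable {α : Type*} [DecidableEq α] {M : Matroid α} [M.Finite] {G : Finset α}

/-- `highIncome` is antitone in `L` (fewer levels). -/
theorem highIncome_anti_right (N : ℕ) {L L' : ℕ} (h : L ≤ L') : highIncome N L' ≤ highIncome N L := by
  unfold highIncome
  apply Finset.sum_le_sum
  intro i _
  split_ifs with h1 h2
  · exact le_rfl
  · omega
  · positivity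
  · exact le_rfl

/-- `highIncome 15 8 ≥ 1` (levels `11` and `12`). -/
theorem one_le_highIncome_fifteen_eight : 1 ≤ highIncome 15 8 :=
  le_trans (by norm_num [Nat.choose, max_def])
    (two_terms_le_highIncome (N := 15) (L := 8) (i := 11) (j := 12) (by norm_num) (by norm_num) (by norm_num)
      (by norm_num))

/-- **`highIncome N 8 ≥ 1` for every `16 ≤ N ≤ 37`** (a single level each). -/
theorem one_le_highIncome_eight_of_le {N : ℕ} (h16 : 16 ≤ N) (h37 : N ≤ 37) : 1 ≤ highIncome N 8 := by
  interval_cases N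
  · exact le_trans (by norm_num [Nat.choose, max_def])
      (term_le_highIncome (N := 16) (L := 8) (i := 11) (by norm_num) (by norm_num))
  · exact le_trans (by norm_num [Nat.choose, max_def])
      (term_le_highIncome (N := 17) (L := 8) (i := 11) (by norm_num) (by norm_num))
  · exact le_trans (by norm_num [Nat.choose, max_def])
      (term_le_highIncome (N := 18) (L := 8) (i := 11) (by norm_num) (by norm_num))
  · exact le_trans (by norm_num [Nat.choose, max_def])
      (term_le_highIncome (N := 19) (L := 8) (i := 12) (by norm_num) (by norm_num))
  · exact le_trans (by norm_num [Nat.choose, max_def])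
      (term_le_highIncome (N := 20) (L := 8) (i := 12) (by norm_num) (by norm_num))
  · exact le_trans (by norm_num [Nat.choose, max_def])
      (term_le_highIncome (N := 21) (L := 8) (i := 13) (by norm_num) (by norm_num))
  · exact le_trans (by norm_num [Nat.choose, max_def])
      (term_le_highIncome (N := 22) (L := 8) (i := 13) (by norm_num) (by norm_num))
  · exact le_trans (by norm_num [Nat.choose, max_def])
      (term_le_highIncome (N := 23) (L := 8) (i := 14) (by norm_num) (by norm_num))
  · exact le_trans (by norm_num [Nat.choose, max_def])
      (term_le_highIncome (N := 24) (L := 8) (i := 15) (by norm_num) (by norm_num))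
  · exact le_trans (by norm_num [Nat.choose, max_def])
      (term_le_highIncome (N := 25) (L := 8) (i := 15) (by norm_num) (by norm_num))
  · exact le_trans (by norm_num [Nat.choose, max_def])
      (term_le_highIncome (N := 26) (L := 8) (i := 16) (by norm_num) (by norm_num))
  · exact le_trans (by norm_num [Nat.choose, max_def])
      (term_le_highIncome (N := 27) (L := 8) (i := 16) (by norm_num) (by norm_num))
  · exact le_trans (by norm_num [Nat.choose, max_def])
      (term_le_highIncome (N := 28) (L := 8) (i := 17) (by norm_num) (by norm_num))
  · exact le_trans (by norm_num [Nat.choose, max_def])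
      (term_le_highIncome (N := 29) (L := 8) (i := 17) (by norm_num) (by norm_num))
  · exact le_trans (by norm_num [Nat.choose, max_def])
      (term_le_highIncome (N := 30) (L := 8) (i := 18) (by norm_num) (by norm_num))
  · exact le_trans (by norm_num [Nat.choose, max_def])
      (term_le_highIncome (N := 31) (L := 8) (i := 19) (by norm_num) (by norm_num))
  · exact le_trans (by norm_num [Nat.choose, max_def])
      (term_le_highIncome (N := 32) (L := 8) (i := 19) (by norm_num) (by norm_num))
  · exact le_trans (by norm_num [Nat.choose, max_def])
      (term_le_highIncome (N := 33) (L := 8) (i := 20) (by norm_num) (by norm_num))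
  · exact le_trans (by norm_num [Nat.choose, max_def])
      (term_le_highIncome (N := 34) (L := 8) (i := 20) (by norm_num) (by norm_num))
  · exact le_trans (by norm_num [Nat.choose, max_def])
      (term_le_highIncome (N := 35) (L := 8) (i := 21) (by norm_num) (by norm_num))
  · exact le_trans (by norm_num [Nat.choose, max_def])
      (term_le_highIncome (N := 36) (L := 8) (i := 21) (by norm_num) (by norm_num))
  · exact le_trans (by norm_num [Nat.choose, max_def])
      (term_le_highIncome (N := 37) (L := 8) (i := 22) (by norm_num) (by norm_num))

/-- `highIncome 14 7 ≥ 1` (`1.28`). -/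
theorem one_le_highIncome_fourteen_seven : 1 ≤ highIncome 14 7 := by
  unfold highIncome
  simp only [Finset.sum_range_succ, Finset.sum_range_zero]
  norm_num [Nat.choose, max_def]

/-- `highIncome 13 6 ≥ 1` (`1.20`). -/
theorem one_le_highIncome_thirteen_six : 1 ≤ highIncome 13 6 := by
  unfold highIncome
  simp only [Finset.sum_range_succ, Finset.sum_range_zero]
  norm_num [Nat.choose, max_def]

/-- `highIncome 12 5 ≥ 1` (`1.10`). -/
theorem one_le_highIncome_twelve_five : 1 ≤ highIncome 12 5 := by
  unfold highIncome
  simp only [Finset.sum_range_succ, Finset.sum_range_zero]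
  norm_num [Nat.choose, max_def]

/-- `highIncome 11 3 ≥ 1` (`1.20`). -/
theorem one_le_highIncome_eleven_three : 1 ≤ highIncome 11 3 := by
  unfold highIncome
  simp only [Finset.sum_range_succ, Finset.sum_range_zero]
  norm_num [Nat.choose, max_def]

/-- **No nine collinear points of `W` and `|W| ≥ 15` ⇒ fair** (the high-level theorem for `15 ≤ |W| ≤ 37`, gen 38's
large-`G` theorem beyond). -/
theorem basis_pair_fair_of_lines_le_eight (hG : G ∈ flatsQ M (5 + 1)) (hd : (gr M \ G).card = 2)
    (hk : kColoops M G = 1) (hs : ∀ e ∈ gr M, ∀ f ∈ gr M, e ≠ f → rkN M {e, f} = 2)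
    (hl : ∀ e ∈ gr M, M.Indep {e}) (hnf : fatClosures M 5 G 2 = ∅) {B : Finset α}
    (hB : B ∈ thinMembers M 5 G) (hnP : ¬ bigP M G B) {z : α} (hz : z ∈ G \ clF M B)
    (hl0 : loss M 5 G B z ≠ 0)
    (hL : ∀ x ∈ G \ insert z B, ∀ y ∈ G \ insert z B, x ≠ y →
      ((G \ insert z B) ∩ clF M {x, y}).card ≤ 8)
    (hN : 15 ≤ (G \ insert z B).card) :
    loss M 5 G B z ≤ rhoL M 5 G B z * lossIncomeH M 5 G (bigP M G) (dshGT2 M 5 G) B z := by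
  rcases Nat.lt_or_ge (G \ insert z B).card 38 with hlt | hge
  · apply basis_pair_fair_of_high_levels hG hd hk hs hl hnf hB hnP hz hl0 (by norm_num) hL
    rcases Nat.lt_or_ge (G \ insert z B).card 16 with h15 | h16
    · have h : (G \ insert z B).card = 15 := by omega
      rw [h]
      exact one_le_highIncome_fifteen_eight
    · exact one_le_highIncome_eight_of_le h16 (by omega)
  · exact basis_pair_fair_of_large hG hd hk hs hl hnf hB hnP hz hl0 hge

/-- **The small high-level cells**: `(|W|, L) = (14, 7), (13, 6), (12, 5), (11, 3)` — at most `L` points of `W` on every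
line and `|W| = N` ⇒ fair. -/
theorem basis_pair_fair_of_lines_le_small (hG : G ∈ flatsQ M (5 + 1)) (hd : (gr M \ G).card = 2)
    (hk : kColoops M G = 1) (hs : ∀ e ∈ gr M, ∀ f ∈ gr M, e ≠ f → rkN M {e, f} = 2)
    (hl : ∀ e ∈ gr M, M.Indep {e}) (hnf : fatClosures M 5 G 2 = ∅) {B : Finset α}
    (hB : B ∈ thinMembers M 5 G) (hnP : ¬ bigP M G B) {z : α} (hz : z ∈ G \ clF M B)
    (hl0 : loss M 5 G B z ≠ 0) {L : ℕ} (hL1 : 1 ≤ L)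
    (hL : ∀ x ∈ G \ insert z B, ∀ y ∈ G \ insert z B, x ≠ y →
      ((G \ insert z B) ∩ clF M {x, y}).card ≤ L)
    (hNL : ((G \ insert z B).card = 14 ∧ L ≤ 7) ∨ ((G \ insert z B).card = 13 ∧ L ≤ 6) ∨
      ((G \ insert z B).card = 12 ∧ L ≤ 5) ∨ ((G \ insert z B).card = 11 ∧ L ≤ 3)) :
    loss M 5 G B z ≤ rhoL M 5 G B z * lossIncomeH M 5 G (bigP M G) (dshGT2 M 5 G) B z := by
  apply basis_pair_fair_of_high_levels hG hd hk hs hl hnf hB hnP hz hl0 hL1 hL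
  rcases hNL with ⟨hN, hL7⟩ | ⟨hN, hL6⟩ | ⟨hN, hL5⟩ | ⟨hN, hL3⟩
  · rw [hN]
    exact le_trans one_le_highIncome_fourteen_seven (highIncome_anti_right 14 hL7)
  · rw [hN]
    exact le_trans one_le_highIncome_thirteen_six (highIncome_anti_right 13 hL6)
  · rw [hN]
    exact le_trans one_le_highIncome_twelve_five (highIncome_anti_right 12 hL5)
  · rw [hN]
    exact le_trans one_le_highIncome_eleven_three (highIncome_anti_right 11 hL3)

end PercRepro.Shadow
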